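import Summits.ResolutionOfSingularities.ResolutionOfSingularities.Theorems.PurelyInseparableDim4AtlasCertTwoComputations
import Summits.ResolutionOfSingularities.ResolutionOfSingularities.Theorems.PurelyInseparableDim4JointHereditaryCertComputations
import HarnessLib

/-!
# Purely inseparable four-folds: COMPUTATIONS for the first escaping certificate over a THREE-VARIABLE root centre (brick S3 (c) v4,
# tranche 1 instance A7-computations; cell `res-dim4-pi`)

[OURS · counted 0] (D-0157 DOOR 2; host item stmt-ResolutionOfSingularities-16155, helper). Nothing here proves resolution of
singularities in dimension ≥ 4 / characteristic `p`. Model computations (no schemes) for the instance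
`F = x₂^p x₄ + x₁^{2p+1} + x₂^{3p+1} + x₃^{2p+1}` (`p ≥ 3`; indices `0..3` below): root host `V(z, x₁, x₂, x₃)` (`S₀ = {0,1,2}`, fibre `ℙ²`),
ONE ESCAPING child `(0, 0, {0,1})` — the LINE `{x₂ = 0}` of the fibre `ℙ²` over the whole base — read on charts `x₁` (`F₀`, centre `{0,1}`) and
`x₃` (`F₂`, centre `{1,2}`); the root chart `x₂` (`F₁`) and the four charts of the child's blow-up (`F₀₀, F₀₁, F₂₁, F₂₂`) are dead. The seven chart
transforms (the `{0,1,2}` exponent laws are `chartExponent_U0/U1/U2_four` of `…JointHereditaryCertComputations`), cleanness and permissibility of the three reading states, `F ≠ 0`, the root locus `x₁ = x₂ = x₃ = 0`. Why this instance: with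
`|S₀| = 3` the escaping child's fibre direction is a genuine line in `ℙ²`, so its cleaned linear conjugates `clean(F(x₁, x₂ − c·x₁, x₃, x₄))`
(certified by `exists_isMarkedResolution_root_conjugate`, p729302) have a NON-COORDINATE escaping child — the first family outside tranche 1's reach
(memo `res-dim4-typ-3/S3c-V4-ATLAS-MEMBERS-DESIGN.md` §16/§17).

AI-produced formalisation, weaker than expert review. bears_on: LADDER-RESOLUTION:D157-DOOR2 (res-dim4-pi · S3 (c) v4 A7 computations).
-/

set_option linter.dupNamespace false -- D-0017: single-problem summit path `Summit.<S>.<S>.…` by design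

noncomputable section

open MvPolynomial Finset

namespace Summit.ResolutionOfSingularities.ResolutionOfSingularities.Theorems.PIDim4

open Literature.AlgebraicGeometry.Resolution
open Literature.AlgebraicGeometry.Resolution.Hauser2010

namespace Equimultiple

section CCertComputations

variable {K : Type} [Field K] {p : ℕ} [hp : Fact p.Prime] [CharP K p]

omit hp [CharP K p] in
/-- `F` in four-exponent form. [folklore] -/
theorem ccert_eq :
    (X 1 ^ p * X 3 + X 0 ^ (2 * p + 1) + X 1 ^ (3 * p + 1) + X 2 ^ (2 * p + 1) : MvPolynomial (Fin 4) K) =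
      C 1 * (X 0 ^ 0 * X 1 ^ p * X 2 ^ 0 * X 3 ^ 1) +
        C 1 * (X 0 ^ (2 * p + 1) * X 1 ^ 0 * X 2 ^ 0 * X 3 ^ 0) +
        C 1 * (X 0 ^ 0 * X 1 ^ (3 * p + 1) * X 2 ^ 0 * X 3 ^ 0) +
        C 1 * (X 0 ^ 0 * X 1 ^ 0 * X 2 ^ (2 * p + 1) * X 3 ^ 0) := by
  simp only [pow_zero, pow_one, mul_one, one_mul, C_1]

omit [CharP K p] in
/-- **Root chart `x₁` (`S₀ = {0,1,2}`, chart 0): `F ↦ F₀` (the child's main reading).** [cite: HauserPerlega2019PRIMS, §2 (the x₁-chart)] -/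
theorem chartTransform_C0_ccert :
    CentreBlowup.chartTransform p ({0, 1, 2} : Finset (Fin 4)) 0
        (X 1 ^ p * X 3 + X 0 ^ (2 * p + 1) + X 1 ^ (3 * p + 1) + X 2 ^ (2 * p + 1) : MvPolynomial (Fin 4) K) =
      C 1 * (X 0 ^ 0 * X 1 ^ p * X 2 ^ 0 * X 3 ^ 1) +
        C 1 * (X 0 ^ (p + 1) * X 1 ^ 0 * X 2 ^ 0 * X 3 ^ 0) +
        C 1 * (X 0 ^ (2 * p + 1) * X 1 ^ (3 * p + 1) * X 2 ^ 0 * X 3 ^ 0) +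
        C 1 * (X 0 ^ (p + 1) * X 1 ^ 0 * X 2 ^ (2 * p + 1) * X 3 ^ 0) := by
  have hp1 : 1 ≤ p := hp.out.one_lt.le
  rw [ccert_eq]
  simp only [C_mul_X_pow_four, CentreBlowup.chartTransform_add, CentreBlowup.chartTransform_monomial, chartExponent_U0_four]
  rw [show 0 + p + 0 - p = 0 by omega, show (2 * p + 1) + 0 + 0 - p = p + 1 by omega, show 0 + (3 * p + 1) + 0 - p = 2 * p + 1 by omega, show 0 + 0 + (2 * p + 1) - p = p + 1 by omega]

omit [CharP K p] in
/-- **Root chart `x₂` (`S₀`, chart 1): `F ↦ F₁` (a lone `y₄`: dead).** [cite: HauserPerlega2019PRIMS, §2 (the x₁-chart)] -/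
theorem chartTransform_C1_ccert :
    CentreBlowup.chartTransform p ({0, 1, 2} : Finset (Fin 4)) 1
        (X 1 ^ p * X 3 + X 0 ^ (2 * p + 1) + X 1 ^ (3 * p + 1) + X 2 ^ (2 * p + 1) : MvPolynomial (Fin 4) K) =
      C 1 * (X 0 ^ 0 * X 1 ^ 0 * X 2 ^ 0 * X 3 ^ 1) +
        C 1 * (X 0 ^ (2 * p + 1) * X 1 ^ (p + 1) * X 2 ^ 0 * X 3 ^ 0) +
        C 1 * (X 0 ^ 0 * X 1 ^ (2 * p + 1) * X 2 ^ 0 * X 3 ^ 0) +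
        C 1 * (X 0 ^ 0 * X 1 ^ (p + 1) * X 2 ^ (2 * p + 1) * X 3 ^ 0) := by
  have hp1 : 1 ≤ p := hp.out.one_lt.le
  rw [ccert_eq]
  simp only [C_mul_X_pow_four, CentreBlowup.chartTransform_add, CentreBlowup.chartTransform_monomial, chartExponent_U1_four]
  rw [show 0 + p + 0 - p = 0 by omega, show (2 * p + 1) + 0 + 0 - p = p + 1 by omega, show 0 + (3 * p + 1) + 0 - p = 2 * p + 1 by omega, show 0 + 0 + (2 * p + 1) - p = p + 1 by omega]

omit [CharP K p] in
/-- **Root chart `x₃` (`S₀`, chart 2): `F ↦ F₂` (the child's extra reading).** [cite: HauserPerlega2019PRIMS, §2 (the x₁-chart)] -/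
theorem chartTransform_C2_ccert :
    CentreBlowup.chartTransform p ({0, 1, 2} : Finset (Fin 4)) 2
        (X 1 ^ p * X 3 + X 0 ^ (2 * p + 1) + X 1 ^ (3 * p + 1) + X 2 ^ (2 * p + 1) : MvPolynomial (Fin 4) K) =
      C 1 * (X 0 ^ 0 * X 1 ^ p * X 2 ^ 0 * X 3 ^ 1) +
        C 1 * (X 0 ^ (2 * p + 1) * X 1 ^ 0 * X 2 ^ (p + 1) * X 3 ^ 0) +
        C 1 * (X 0 ^ 0 * X 1 ^ (3 * p + 1) * X 2 ^ (2 * p + 1) * X 3 ^ 0) +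
        C 1 * (X 0 ^ 0 * X 1 ^ 0 * X 2 ^ (p + 1) * X 3 ^ 0) := by
  have hp1 : 1 ≤ p := hp.out.one_lt.le
  rw [ccert_eq]
  simp only [C_mul_X_pow_four, CentreBlowup.chartTransform_add, CentreBlowup.chartTransform_monomial, chartExponent_U2_four]
  rw [show 0 + p + 0 - p = 0 by omega, show (2 * p + 1) + 0 + 0 - p = p + 1 by omega, show 0 + (3 * p + 1) + 0 - p = 2 * p + 1 by omega, show 0 + 0 + (2 * p + 1) - p = p + 1 by omega]

omit hp [CharP K p] in
/-- **Chart `y₁` of the child's blow-up on its main reading (`{0,1}`, chart 0): `F₀ ↦ F₀₀` (dead).** [cite: HauserPerlega2019PRIMS, §2 (the x₁-chart)] -/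
theorem chartTransform_U0_ccert :
    CentreBlowup.chartTransform p ({0, 1} : Finset (Fin 4)) 0
        (C 1 * (X 0 ^ 0 * X 1 ^ p * X 2 ^ 0 * X 3 ^ 1) +
          C 1 * (X 0 ^ (p + 1) * X 1 ^ 0 * X 2 ^ 0 * X 3 ^ 0) +
          C 1 * (X 0 ^ (2 * p + 1) * X 1 ^ (3 * p + 1) * X 2 ^ 0 * X 3 ^ 0) +
          C 1 * (X 0 ^ (p + 1) * X 1 ^ 0 * X 2 ^ (2 * p + 1) * X 3 ^ 0) : MvPolynomial (Fin 4) K) =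
      C 1 * (X 0 ^ 0 * X 1 ^ p * X 2 ^ 0 * X 3 ^ 1) +
        C 1 * (X 0 ^ 1 * X 1 ^ 0 * X 2 ^ 0 * X 3 ^ 0) +
        C 1 * (X 0 ^ (4 * p + 2) * X 1 ^ (3 * p + 1) * X 2 ^ 0 * X 3 ^ 0) +
        C 1 * (X 0 ^ 1 * X 1 ^ 0 * X 2 ^ (2 * p + 1) * X 3 ^ 0) := by
  simp only [C_mul_X_pow_four, CentreBlowup.chartTransform_add, CentreBlowup.chartTransform_monomial, chartExponent_S0_four]
  rw [show 0 + p - p = 0 by omega, show (p + 1) + 0 - p = 1 by omega, show (2 * p + 1) + (3 * p + 1) - p = 4 * p + 2 by omega]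

omit hp [CharP K p] in
/-- **Chart `y₂` of the child's blow-up on its main reading (`{0,1}`, chart 1): `F₀ ↦ F₀₁` (dead).** [cite: HauserPerlega2019PRIMS, §2 (the x₁-chart)] -/
theorem chartTransform_U1_ccert :
    CentreBlowup.chartTransform p ({0, 1} : Finset (Fin 4)) 1
        (C 1 * (X 0 ^ 0 * X 1 ^ p * X 2 ^ 0 * X 3 ^ 1) +
          C 1 * (X 0 ^ (p + 1) * X 1 ^ 0 * X 2 ^ 0 * X 3 ^ 0) +
          C 1 * (X 0 ^ (2 * p + 1) * X 1 ^ (3 * p + 1) * X 2 ^ 0 * X 3 ^ 0) +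
          C 1 * (X 0 ^ (p + 1) * X 1 ^ 0 * X 2 ^ (2 * p + 1) * X 3 ^ 0) : MvPolynomial (Fin 4) K) =
      C 1 * (X 0 ^ 0 * X 1 ^ 0 * X 2 ^ 0 * X 3 ^ 1) +
        C 1 * (X 0 ^ (p + 1) * X 1 ^ 1 * X 2 ^ 0 * X 3 ^ 0) +
        C 1 * (X 0 ^ (2 * p + 1) * X 1 ^ (4 * p + 2) * X 2 ^ 0 * X 3 ^ 0) +
        C 1 * (X 0 ^ (p + 1) * X 1 ^ 1 * X 2 ^ (2 * p + 1) * X 3 ^ 0) := by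
  simp only [C_mul_X_pow_four, CentreBlowup.chartTransform_add, CentreBlowup.chartTransform_monomial, chartExponent_S1_four]
  rw [show 0 + p - p = 0 by omega, show (p + 1) + 0 - p = 1 by omega, show (2 * p + 1) + (3 * p + 1) - p = 4 * p + 2 by omega]

omit hp [CharP K p] in
/-- **Chart `y₂` of the child's blow-up on its extra reading (`{1,2}`, chart 1): `F₂ ↦ F₂₁` (dead).** [cite: HauserPerlega2019PRIMS, §2 (the x₁-chart)] -/
theorem chartTransform_W1_ccert :
    CentreBlowup.chartTransform p ({1, 2} : Finset (Fin 4)) 1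
        (C 1 * (X 0 ^ 0 * X 1 ^ p * X 2 ^ 0 * X 3 ^ 1) +
          C 1 * (X 0 ^ (2 * p + 1) * X 1 ^ 0 * X 2 ^ (p + 1) * X 3 ^ 0) +
          C 1 * (X 0 ^ 0 * X 1 ^ (3 * p + 1) * X 2 ^ (2 * p + 1) * X 3 ^ 0) +
          C 1 * (X 0 ^ 0 * X 1 ^ 0 * X 2 ^ (p + 1) * X 3 ^ 0) : MvPolynomial (Fin 4) K) =
      C 1 * (X 0 ^ 0 * X 1 ^ 0 * X 2 ^ 0 * X 3 ^ 1) +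
        C 1 * (X 0 ^ (2 * p + 1) * X 1 ^ 1 * X 2 ^ (p + 1) * X 3 ^ 0) +
        C 1 * (X 0 ^ 0 * X 1 ^ (4 * p + 2) * X 2 ^ (2 * p + 1) * X 3 ^ 0) +
        C 1 * (X 0 ^ 0 * X 1 ^ 1 * X 2 ^ (p + 1) * X 3 ^ 0) := by
  simp only [C_mul_X_pow_four, CentreBlowup.chartTransform_add, CentreBlowup.chartTransform_monomial, chartExponent_R1_four]
  rw [show p + 0 - p = 0 by omega, show 0 + (p + 1) - p = 1 by omega, show (3 * p + 1) + (2 * p + 1) - p = 4 * p + 2 by omega]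

omit hp [CharP K p] in
/-- **Chart `y₃` of the child's blow-up on its extra reading (`{1,2}`, chart 2): `F₂ ↦ F₂₂` (dead).** [cite: HauserPerlega2019PRIMS, §2 (the x₁-chart)] -/
theorem chartTransform_W2_ccert :
    CentreBlowup.chartTransform p ({1, 2} : Finset (Fin 4)) 2
        (C 1 * (X 0 ^ 0 * X 1 ^ p * X 2 ^ 0 * X 3 ^ 1) +
          C 1 * (X 0 ^ (2 * p + 1) * X 1 ^ 0 * X 2 ^ (p + 1) * X 3 ^ 0) +
          C 1 * (X 0 ^ 0 * X 1 ^ (3 * p + 1) * X 2 ^ (2 * p + 1) * X 3 ^ 0) +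
          C 1 * (X 0 ^ 0 * X 1 ^ 0 * X 2 ^ (p + 1) * X 3 ^ 0) : MvPolynomial (Fin 4) K) =
      C 1 * (X 0 ^ 0 * X 1 ^ p * X 2 ^ 0 * X 3 ^ 1) +
        C 1 * (X 0 ^ (2 * p + 1) * X 1 ^ 0 * X 2 ^ 1 * X 3 ^ 0) +
        C 1 * (X 0 ^ 0 * X 1 ^ (3 * p + 1) * X 2 ^ (4 * p + 2) * X 3 ^ 0) +
        C 1 * (X 0 ^ 0 * X 1 ^ 0 * X 2 ^ 1 * X 3 ^ 0) := by
  simp only [C_mul_X_pow_four, CentreBlowup.chartTransform_add, CentreBlowup.chartTransform_monomial, chartExponent_R2_four]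
  rw [show p + 0 - p = 0 by omega, show 0 + (p + 1) - p = 1 by omega, show (3 * p + 1) + (2 * p + 1) - p = 4 * p + 2 by omega]

omit hp [CharP K p] in
/-- `p ∤ 3p + 1` for `p ≥ 2`. [folklore] -/
theorem not_dvd_three_mul_succ_of_two_le (hp2 : 2 ≤ p) : ¬ p ∣ (3 * p + 1) := fun h => by
  have h1 : p ∣ 1 := (Nat.dvd_add_right (dvd_mul_left p 3)).mp h
  exact not_dvd_one_of_two_le hp2 h1

omit hp [CharP K p] in
/-- **`F` is clean.** [cite: HauserPerlega2019PRIMS, §2 (cleaning)] -/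
theorem isClean_ccert (hp2 : 2 ≤ p) :
    Literature.Barriers.ResolutionOfSingularities.HauserPerlega.IsClean p
      (X 1 ^ p * X 3 + X 0 ^ (2 * p + 1) + X 1 ^ (3 * p + 1) + X 2 ^ (2 * p + 1) : MvPolynomial (Fin 4) K) := by
  rw [ccert_eq]
  exact isClean_four_of_witness ⟨3, by simpa using not_dvd_one_of_two_le hp2⟩ ⟨0, by simpa using not_dvd_two_mul_succ_of_two_le hp2⟩ ⟨1, by simpa using not_dvd_three_mul_succ_of_two_le hp2⟩ ⟨2, by simpa using not_dvd_two_mul_succ_of_two_le hp2⟩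

omit hp [CharP K p] in
/-- **`F₀` is clean.** [cite: HauserPerlega2019PRIMS, §2 (cleaning)] -/
theorem isClean_F0_ccert (hp2 : 2 ≤ p) :
    Literature.Barriers.ResolutionOfSingularities.HauserPerlega.IsClean p
      (C 1 * (X 0 ^ 0 * X 1 ^ p * X 2 ^ 0 * X 3 ^ 1) +
        C 1 * (X 0 ^ (p + 1) * X 1 ^ 0 * X 2 ^ 0 * X 3 ^ 0) +
        C 1 * (X 0 ^ (2 * p + 1) * X 1 ^ (3 * p + 1) * X 2 ^ 0 * X 3 ^ 0) +
        C 1 * (X 0 ^ (p + 1) * X 1 ^ 0 * X 2 ^ (2 * p + 1) * X 3 ^ 0) : MvPolynomial (Fin 4) K) := by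
  exact isClean_four_of_witness ⟨3, by simpa using not_dvd_one_of_two_le hp2⟩ ⟨0, by simpa using not_dvd_succ_of_two_le hp2⟩ ⟨0, by simpa using not_dvd_two_mul_succ_of_two_le hp2⟩ ⟨0, by simpa using not_dvd_succ_of_two_le hp2⟩

omit hp [CharP K p] in
/-- **`F₂` is clean.** [cite: HauserPerlega2019PRIMS, §2 (cleaning)] -/
theorem isClean_F2_ccert (hp2 : 2 ≤ p) :
    Literature.Barriers.ResolutionOfSingularities.HauserPerlega.IsClean p
      (C 1 * (X 0 ^ 0 * X 1 ^ p * X 2 ^ 0 * X 3 ^ 1) +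
        C 1 * (X 0 ^ (2 * p + 1) * X 1 ^ 0 * X 2 ^ (p + 1) * X 3 ^ 0) +
        C 1 * (X 0 ^ 0 * X 1 ^ (3 * p + 1) * X 2 ^ (2 * p + 1) * X 3 ^ 0) +
        C 1 * (X 0 ^ 0 * X 1 ^ 0 * X 2 ^ (p + 1) * X 3 ^ 0) : MvPolynomial (Fin 4) K) := by
  exact isClean_four_of_witness ⟨3, by simpa using not_dvd_one_of_two_le hp2⟩ ⟨0, by simpa using not_dvd_two_mul_succ_of_two_le hp2⟩ ⟨1, by simpa using not_dvd_three_mul_succ_of_two_le hp2⟩ ⟨2, by simpa using not_dvd_succ_of_two_le hp2⟩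

omit [CharP K p] in
/-- **`F ≠ 0`** (the coefficient of `x₂^p x₄` is `1`). [folklore] -/
theorem ccert_ne_zero :
    (X 1 ^ p * X 3 + X 0 ^ (2 * p + 1) + X 1 ^ (3 * p + 1) + X 2 ^ (2 * p + 1) : MvPolynomial (Fin 4) K) ≠ 0 := by
  have hp0 : p ≠ 0 := hp.out.ne_zero
  intro h
  have hc := congrArg (coeff (Finsupp.single (0 : Fin 4) 0 + Finsupp.single 1 p + Finsupp.single 2 0 +
    Finsupp.single 3 1)) h
  rw [ccert_eq, C_mul_X_pow_four, C_mul_X_pow_four, C_mul_X_pow_four, C_mul_X_pow_four, coeff_add, coeff_add, coeff_add,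
    coeff_monomial, coeff_monomial, coeff_monomial, coeff_monomial, if_pos rfl, if_neg, if_neg, if_neg, coeff_zero] at hc
  · simp at hc
  · intro h'; have := DFunLike.congr_fun h' 3; simp at this
  · intro h'; have := DFunLike.congr_fun h' 3; simp at this
  · intro h'; have := DFunLike.congr_fun h' 3; simp at this

omit [CharP K p] in
/-- **`V(z, x₁, x₂, x₃)` is permissible for `z^p + F`.** [cite: HauserPerlega2019PRIMS, §2 (condition (1))] -/
theorem isPermissibleCentre_S_ccert :
    IsPermissibleCentre p ({0, 1, 2} : Finset (Fin 4))
      (X 1 ^ p * X 3 + X 0 ^ (2 * p + 1) + X 1 ^ (3 * p + 1) + X 2 ^ (2 * p + 1) : MvPolynomial (Fin 4) K) := by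
  have hp1 : 1 ≤ p := hp.out.one_lt.le
  refine ⟨⟨0, by simp⟩, Finset.le_inf fun d hd => ?_⟩
  rw [ccert_eq] at hd
  rcases mem_support_four hd with rfl | rfl | rfl | rfl <;>
    simp [CentreBlowup.degIn_triple (show (0 : Fin 4) ≠ 1 by decide) (show (0 : Fin 4) ≠ 2 by decide)
      (show (1 : Fin 4) ≠ 2 by decide)]
  all_goals (norm_cast; omega)

omit hp [CharP K p] in
/-- **`V(z, y₁, y₂)` is permissible for `z^p + F₀`** (the main reading of the child). [cite: HauserPerlega2019PRIMS, §2 (condition (1))] -/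
theorem isPermissibleCentre_T_F0_ccert :
    IsPermissibleCentre p ({0, 1} : Finset (Fin 4))
      (C 1 * (X 0 ^ 0 * X 1 ^ p * X 2 ^ 0 * X 3 ^ 1) +
        C 1 * (X 0 ^ (p + 1) * X 1 ^ 0 * X 2 ^ 0 * X 3 ^ 0) +
        C 1 * (X 0 ^ (2 * p + 1) * X 1 ^ (3 * p + 1) * X 2 ^ 0 * X 3 ^ 0) +
        C 1 * (X 0 ^ (p + 1) * X 1 ^ 0 * X 2 ^ (2 * p + 1) * X 3 ^ 0) : MvPolynomial (Fin 4) K) := by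
  refine ⟨⟨0, by simp⟩, Finset.le_inf fun d hd => ?_⟩
  rcases mem_support_four hd with rfl | rfl | rfl | rfl <;>
    simp [CentreBlowup.degIn_pair (show (0 : Fin 4) ≠ 1 by decide)]
  all_goals (norm_cast; omega)

omit hp [CharP K p] in
/-- **`V(z, y₂, y₃)` is permissible for `z^p + F₂`** (the extra reading of the child). [cite: HauserPerlega2019PRIMS, §2 (condition (1))] -/
theorem isPermissibleCentre_R_F2_ccert :
    IsPermissibleCentre p ({1, 2} : Finset (Fin 4))
      (C 1 * (X 0 ^ 0 * X 1 ^ p * X 2 ^ 0 * X 3 ^ 1) +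
        C 1 * (X 0 ^ (2 * p + 1) * X 1 ^ 0 * X 2 ^ (p + 1) * X 3 ^ 0) +
        C 1 * (X 0 ^ 0 * X 1 ^ (3 * p + 1) * X 2 ^ (2 * p + 1) * X 3 ^ 0) +
        C 1 * (X 0 ^ 0 * X 1 ^ 0 * X 2 ^ (p + 1) * X 3 ^ 0) : MvPolynomial (Fin 4) K) := by
  refine ⟨⟨1, by simp⟩, Finset.le_inf fun d hd => ?_⟩
  rcases mem_support_four hd with rfl | rfl | rfl | rfl <;>
    simp [CentreBlowup.degIn_pair (show (1 : Fin 4) ≠ 2 by decide)]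
  all_goals (norm_cast; omega)

/-- **The root locus**: order `≥ 2 ≤ p` of `F(x + b)` forces `b₁ = b₂ = b₃ = 0` (`∂₁ F = (2p+1) x₁^{2p}`, `∂₂ F = p·… + (3p+1) x₂^{3p}`,
`∂₃ F = (2p+1) x₃^{2p}`). [cite: Hauser2010, §F (equiconstant points)] -/
theorem roots_ccert (b : Fin 4 → K)
    (H : ∀ d : Fin 4 →₀ ℕ, d ≠ 0 → d.degree < p → coeff d (PointBlowup.translate b
      (X 1 ^ p * X 3 + X 0 ^ (2 * p + 1) + X 1 ^ (3 * p + 1) + X 2 ^ (2 * p + 1) : MvPolynomial (Fin 4) K)) = 0) :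
    b 0 = 0 ∧ b 1 = 0 ∧ b 2 = 0 := by
  have hp0 : p ≠ 0 := hp.out.ne_zero
  have h0 := eval_pderiv_eq_zero_of_forall_coeff b _ H 0
  have h1 := eval_pderiv_eq_zero_of_forall_coeff b _ H 1
  have h2 := eval_pderiv_eq_zero_of_forall_coeff b _ H 2
  simp [(pderiv (0 : Fin 4)).leibniz_pow, (pderiv (1 : Fin 4)).leibniz_pow, (pderiv (2 : Fin 4)).leibniz_pow, hp0] at h0 h1 h2
  exact ⟨h0, h1, h2⟩

end CCertComputations

end Equimultiple

end Summit.ResolutionOfSingularities.ResolutionOfSingularities.Theorems.PIDim4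

end
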